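import Literature.NumberTheory.LFunctions.StarkQuadraticSubfieldZero
import Literature.NumberTheory.LFunctions.ClassGroupLFunctionNoExceptionalZeroOddDegree
import Literature.NumberTheory.QuadraticFields.QuadraticDedekindZetaZeros
import Literature.NumberTheory.QuadraticFields.JacobiCharacterPrimitiveProofs
import HarnessLib

/-!
# The exceptional zero of a real class group `L`-function is a zero of a quadratic Dirichlet
# `L`-function (every degree); Siegel's theorem for class group `L`-functions

Topic `Literature/NumberTheory/LFunctions`, namespace `Literature.NumberTheory.LFunctions.NumberField`.
Theorem-only file (no definition, no named fact, no `sorry`), unconditional.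

Let `K` be a number field of degree `n > 1`, `χ : Cl(𝓞 K) → ℂˣ` a REAL class group character
(`χ² = 1`, the trivial character included) and `β` real with
`1 − 1/(8·(2n)!·log|d_K|) ≤ β < 1` — the window in which the Landau–Page / Thorner–Zaman dichotomy for
the Hilbert class field places its possible exceptional zero `β₁` ([ThornerZaman2019, Thm. 1.4 and §3],
there `β₁ > 1 − 1/(8 log(|d_K| n^n))`, a wider window).

**Theorem** (`exists_dirichletCharacter_realZero_of_classGroupLFunction_eq_zero`). If `L(β, χ) = 0`
then there is a PRIMITIVE quadratic Dirichlet character `κ` modulo some `M ≥ 3` with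
`M^n ∣ d_K²` (so `M ≤ |d_K|^{2/n} ≤ |d_K|`) and `L(β, κ) = 0`. In words: in EVERY degree the
exceptional zero of a class group `L`-function is a Landau–Siegel zero of a quadratic Dirichlet
`L`-function of conductor at most `|d_K|^{2/n}` (namely `κ = χ_{d_k}` for a quadratic field `k` inside
the quadratic class field `E` of `χ`, `k ⊆ K` if `χ = 1`).

Proof. `χ = 1`: `L(s, 1) = ζ_K` and Stark's Theorem 3 in locating form
(`exists_quadratic_dedekindZetaCont_eq_zero`, window `1 − 1/(4·n!·log|d_K|)`) gives a quadratic
`k ⊆ K` with `ζ_k(β) = 0`; `|d_k|^{[K:k]} ∣ |d_K|`. `χ ≠ 1`: the quadratic class field `E ⊇ K` of `χ`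
(tree CFT, `exists_quadratic_classField_dedekindZetaCont_eq_zero`: `[E:K] = 2`, unramified at all finite
primes, `ζ_E(β) = 0`), `|d_E| = |d_K|²`, `[E:ℚ] = 2n`; Stark's Theorem 3 for `E` gives a quadratic
`k ⊆ E` with `ζ_k(β) = 0`, and `|d_k|^{[E:k]} ∣ |d_E|`, `[E:k] = n`. In both cases
`ζ_k = ζ · L(·, κ)` for the (primitive, quadratic) Kronecker character `κ` mod `|d_k|`
(`Quadratic.exists_primitive_kroneckerChar`) and `ζ(β) < 0`, so `L(β, κ) = 0`.

**Corollaries.**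
* `classGroupLFunction_siegel` — **Siegel's theorem for class group `L`-functions, every degree**:
  for `n > 1` and `ε > 0` there is `C = C(n, ε) > 0` (ineffective) with `C·|d_K|^{−ε} ≤ 1 − β` for
  every number field `K` of degree `n`, every real class group character `χ` and every real zero
  `β < 1` of `L(s, χ)` (Siegel's bound for `κ`, tree `Quadratic`/`Siegel.exists_one_sub_realZero_ge`,
  inside the window; the window's edge outside it).
* `dedekindZetaCont_siegel` — the case `χ = 1`: `C(n,ε)|d_K|^{−ε} ≤ 1 − β` for every real zero
  `β < 1` of `ζ_K`, every `K` of degree `n` (Brauer–Siegel direction via Stark, cf. [Stark1974, §1]).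

The odd-degree companion `ClassGroupLFunctionNoExceptionalZeroOddDegree.lean` shows the window is
zero-FREE when `n` is odd; the present file is what survives in even degree. The bridge
"`NoSiegelZeros` ⇒ no exceptional zero in any degree" is in
`ClassGroupLFunctionExceptionalZeroOfNoSiegel.lean`.

IN PRINT (found by the freshness sweep after landing): the descent of this file, for a general quadratic
Hecke character `ψ` of `k` with conductor `q(ψ)` and the same window `1/((2[k:ℚ])!·8 log q(ψ))`, is
**Lemma 12 (Stark)** of Cho–Lemke Oliver–Zaman, *Effective Brauer–Siegel theorems for Artin `L`-functions*,
arXiv:2510.02309 (2025), §5 ("there exists a quadratic field `ℚ(√d)` … contained in `F` and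
`ζ_{ℚ(√d)}(β) = 0` … `d^{[k:ℚ]}` must divide `D_F = D_k q(ψ)`"); the present file is an independent
kernel-checked certification of its conductor-one (class group) case. [ChoLemkeOliverZaman2025]

## References

* P. J. Cho, R. J. Lemke Oliver, A. Zaman, *Effective Brauer–Siegel theorems for Artin L-functions*,
  arXiv:2510.02309 (2025), §5 Lemma 12 (Stark), Lemma 13. [ChoLemkeOliverZaman2025]
* H. M. Stark, *Some effective cases of the Brauer–Siegel theorem*, Invent. Math. 23 (1974) 135–152,
  Lemma 3, Theorem 3, and §1. [Stark1974]
* V. Kumar Murty, *Stark zeros in certain towers of fields*, Math. Res. Lett. 6 (1999) 511–519,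
  p. 512 (4). [Murty1999StarkZeros]
* J. Thorner, A. Zaman, *A unified and improved Chebotarev density theorem*, Algebra Number Theory 13
  (2019), Thm. 1.4 and §3. [ThornerZaman2019]
* H. L. Montgomery, R. C. Vaughan, *Multiplicative Number Theory I*, CUP 2007, Cor. 11.15 (Siegel),
  Thm. 9.13, §10.1 Ex. 26. [MontgomeryVaughan2007]
-/

noncomputable section

open scoped NumberField nonZeroDivisors NumberTheorySymbols
open Complex NumberField IsDedekindDomain Module

namespace Literature.NumberTheory.QuadraticFields.Quadratic

open Literature.NumberTheory.LFunctions

/-- **The Kronecker character of a quadratic field is primitive** (refinement of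
`exists_kroneckerChar`): for `[k : ℚ] = 2` there is a PRIMITIVE Dirichlet character `κ ≠ 1`, `κ² = 1`,
modulo `M = |d_k|`, with `ζ_k(s) = ζ(s) L(s, κ)` for `Re s > 1` (odd `d_k`: the Jacobi character modulo
the odd square-free `|d_k|`, primitive by `isPrimitive_jacobiChar`; even `d_k = 4m`: the Kronecker
character mod `4|m|`, primitive by `isPrimitive_of_forall_odd`).
[cite: MontgomeryVaughan2007, §10.1 Exercise 26 and Theorem 9.13] -/
theorem exists_primitive_kroneckerChar {k : Type*} [Field k] [NumberField k] (h2 : finrank ℚ k = 2) :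
    ∃ (M : ℕ) (_ : NeZero M) (κ : DirichletCharacter ℂ M), M = (NumberField.discr k).natAbs ∧ κ ≠ 1 ∧
      κ ^ 2 = 1 ∧ κ.IsPrimitive ∧
      ∀ s : ℂ, 1 < s.re → NumberField.dedekindZeta k s = riemannZeta s * LSeries (fun n ↦ κ n) s := by
  rcases isFundamentalDiscriminant_discr (K := k) h2 with ⟨h1, hsqf, -⟩ | ⟨h4, hm4, hsq⟩
  · -- odd discriminant: the Jacobi character mod `|d_k|`, odd and square-free
    have hodd : Odd (NumberField.discr k) := by
      rw [Int.odd_iff]; omega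
    haveI := neZero_natAbs_discr (K := k)
    have hoddN : Odd (NumberField.discr k).natAbs := Int.natAbs_odd.mpr hodd
    have hsqN : Squarefree (NumberField.discr k).natAbs := Int.squarefree_natAbs.mpr hsqf
    exact ⟨(NumberField.discr k).natAbs, inferInstance, jacobiChar (NumberField.discr k).natAbs, rfl,
      jacobiChar_natAbs_discr_ne_one h2 hodd,
      MulChar.IsQuadratic.sq_eq_one (fun a ↦ jacobiChar_trichotomy a),
      isPrimitive_jacobiChar hoddN hsqN,
      fun s hs ↦ dedekindZeta_eq_riemannZeta_mul_LSeries h2 hodd hs⟩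
  · -- even discriminant `d = 4m`: the Kronecker character mod `4|m|`
    set m : ℤ := NumberField.discr k / 4 with hm
    have hm0 : m ≠ 0 := hsq.ne_zero
    have hdm : NumberField.discr k = 4 * m := by rw [hm, Int.mul_ediv_cancel' h4]
    haveI : NeZero (4 * m.natAbs) := ⟨mul_ne_zero (by norm_num) (Int.natAbs_ne_zero.mpr hm0)⟩
    obtain ⟨κ, hκ⟩ := exists_dirichletCharacter_four_mul m hm0
    have hprim : κ.IsPrimitive := isPrimitive_of_forall_odd hm4 hsq hκ
    have hM : 4 * m.natAbs = (NumberField.discr k).natAbs := by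
      rw [hdm, Int.natAbs_mul]; rfl
    have hne : κ ≠ 1 := by
      intro h
      have hc : κ.conductor = 4 * m.natAbs := hprim
      rw [h, DirichletCharacter.conductor_one] at hc
      have := Int.natAbs_pos.mpr hm0
      omega
    refine ⟨4 * m.natAbs, inferInstance, κ, hM, hne, (isQuadratic_of_forall_odd hm0 hκ).sq_eq_one, hprim,
      fun s hs ↦ ?_⟩
    refine dedekindZeta_eq_riemannZeta_mul_LSeries_of_kronecker h2 κ (fun p hp hp2 ↦ ?_) ?_ hs
    · -- odd primes: `κ(p) = (m/p) = (4m/p) = (d/p)`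
      have hpodd : Odd p := hp.odd_of_ne_two hp2
      rw [hκ p hpodd, hdm, jacobiSym.mul_left]
      have h4 : J(4 | p) = 1 := by
        rw [show (4 : ℤ) = 2 ^ 2 by norm_num]
        exact jacobiSym.sq_one' (by
          rw [show (2 : ℤ) = ((2 : ℕ) : ℤ) by rfl, Int.gcd_natCast_natCast]
          exact (Nat.coprime_primes Nat.prime_two hp).mpr (Ne.symm hp2))
      rw [h4, one_mul]
    · -- the prime `2`: `κ(2) = 0` and `d ≡ 0, 4 (mod 8)`
      have h81 : NumberField.discr k % 8 ≠ 1 := by omega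
      have h85 : NumberField.discr k % 8 ≠ 5 := by omega
      rw [if_neg h81, if_neg h85]
      refine apply_eq_zero_of_even (m := m) ?_
      have hlt : 2 < 4 * m.natAbs := by have := Int.natAbs_pos.mpr hm0; omega
      have : ((2 : ℕ) : ZMod (4 * m.natAbs)) = 2 := by norm_cast
      rw [← this, ZMod.val_natCast, Nat.mod_eq_of_lt hlt]
      exact even_two

/-- **A real zero of a quadratic `ζ_k` in `(0,1)` is a zero of its primitive Kronecker character's
`L`-function**, with modulus `M = |d_k| ≥ 3`. [cite: MontgomeryVaughan2007, §10.1 Exercise 26] -/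
theorem exists_primitive_LFunction_eq_zero_of_realZero {k : Type*} [Field k] [NumberField k]
    (h2 : finrank ℚ k = 2) {β : ℝ} (h0 : 0 < β) (h1 : β < 1) (hβ : dedekindZetaCont k β = 0) :
    ∃ (M : ℕ) (_ : NeZero M) (κ : DirichletCharacter ℂ M), M = (NumberField.discr k).natAbs ∧ 3 ≤ M ∧
      κ ≠ 1 ∧ κ ^ 2 = 1 ∧ κ.IsPrimitive ∧ κ.LFunction β = 0 := by
  obtain ⟨M, hM0, κ, hM, hκ, hsq, hprim, hfac⟩ := exists_primitive_kroneckerChar (k := k) h2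
  refine ⟨M, hM0, κ, hM, ?_, hκ, hsq, hprim, LFunction_eq_zero_of_realZero hκ hfac h0 h1 hβ⟩
  have h3 := NumberField.abs_discr_gt_two (K := k) (by rw [h2]; exact one_lt_two)
  rw [Int.abs_eq_natAbs] at h3
  rw [hM]
  exact_mod_cast (show (3 : ℤ) ≤ ((NumberField.discr k).natAbs : ℤ) by omega)

end Literature.NumberTheory.QuadraticFields.Quadratic

namespace Literature.NumberTheory.LFunctions.NumberField

open Literature.NumberTheory.GaloisRepresentations Literature.NumberTheory.NumberFields
  Literature.NumberTheory.LFunctions Literature.NumberTheory.QuadraticFields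

/-- **Tower divisibility of discriminants**: `|d_k|^{[L:k]} ∣ |d_L|` for number fields `k ⊆ L`
(`d_L = ± N(𝔡_{L/k}) · d_k^{[L:k]}`, Mathlib
`NumberField.natAbs_discr_eq_absNorm_differentIdeal_mul_natAbs_discr_pow`).
[cite: NeukirchANT1999, Ch. III Cor. (2.10)] -/
theorem natAbs_discr_pow_finrank_dvd (k L : Type*) [Field k] [NumberField k] [Field L] [NumberField L]
    [Algebra k L] : (discr k).natAbs ^ Module.finrank k L ∣ (discr L).natAbs := by
  rw [NumberField.natAbs_discr_eq_absNorm_differentIdeal_mul_natAbs_discr_pow k (𝓞 k) L (𝓞 L)]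
  exact Dvd.intro_left _ rfl

/-- Window comparison: `1/(8·(2n)!·log d) ≤ 1/(4·n!·log d)` for `log d > 0`. [folklore] -/
theorem inv_eight_twoFactorial_le {n : ℕ} {L : ℝ} (hL : 0 < L) :
    1 / (8 * ((2 * n).factorial : ℝ) * L) ≤ 1 / (4 * ((n).factorial : ℝ) * L) := by
  have hfacn0 : (0 : ℝ) < ((n).factorial : ℝ) := by exact_mod_cast Nat.factorial_pos _
  have hle : ((n).factorial : ℝ) ≤ ((2 * n).factorial : ℝ) := by
    exact_mod_cast Nat.factorial_le (by omega)
  apply one_div_le_one_div_of_le (by positivity)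
  nlinarith

/-- **The exceptional zero of a real class group `L`-function is a zero of a primitive quadratic
Dirichlet `L`-function (every degree).**  Let `K` be a number field of degree `n > 1`, `χ` a real class
group character (`χ² = 1`, `χ = 1` included) and `β` real with `1 − 1/(8·(2n)!·log|d_K|) ≤ β < 1` and
`L(β, χ) = 0`. Then `L(β, κ) = 0` for a primitive quadratic Dirichlet character `κ ≠ 1` modulo some
`M ≥ 3` with `M^n ∣ |d_K|²` (`κ` = the Kronecker character of a quadratic field `k` inside the quadratic
class field of `χ`, resp. inside `K` when `χ = 1`; `M = |d_k|`).
[cite: Stark1974, Thm. 3 and Lemma 3] [cite: Murty1999StarkZeros, p. 512 (4)]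
[cite: ThornerZaman2019, Thm. 1.4 and §3] -/
theorem exists_dirichletCharacter_realZero_of_classGroupLFunction_eq_zero (K : Type) [Field K]
    [NumberField K] (hK : 1 < finrank ℚ K) (χ : ClassGroup (𝓞 K) →* ℂˣ) (hχ : χ * χ = 1) {β : ℝ}
    (hβ : 1 - 1 / (8 * ((2 * finrank ℚ K).factorial : ℝ) * Real.log ((discr K).natAbs : ℝ)) ≤ β)
    (hβ1 : β < 1) (h0 : classGroupLFunction K χ β = 0) :
    ∃ (M : ℕ) (_ : NeZero M) (κ : DirichletCharacter ℂ M), 3 ≤ M ∧ M ^ finrank ℚ K ∣ (discr K).natAbs ^ 2 ∧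
      κ ≠ 1 ∧ κ ^ 2 = 1 ∧ κ.IsPrimitive ∧ κ.LFunction β = 0 := by
  classical
  set n : ℕ := finrank ℚ K with hn
  -- `|d_K| ≥ 3`, `log|d_K| > 0`, `0 < β`
  have hdK : 3 ≤ (discr K).natAbs := three_le_natAbs_discr K hK
  have hd3 : (3 : ℝ) ≤ ((discr K).natAbs : ℝ) := by exact_mod_cast hdK
  have hlog : 0 < Real.log ((discr K).natAbs : ℝ) := Real.log_pos (by linarith)
  have hne1 : ((β : ℝ) : ℂ) ≠ 1 := by
    intro h; apply hβ1.ne; exact_mod_cast h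
  have hfac0 : (0 : ℝ) < ((2 * n).factorial : ℝ) := by exact_mod_cast Nat.factorial_pos _
  -- the weaker window `1 − 1/(4·n!·log d) ≤ β`, and `0 < β`
  have hβ' : 1 - 1 / (4 * ((n).factorial : ℝ) * Real.log ((discr K).natAbs : ℝ)) ≤ β := by
    have := inv_eight_twoFactorial_le (n := n) hlog
    linarith
  have hk2 : 2 ≤ (n).factorial := by
    have h := Nat.factorial_le (Nat.succ_le_of_lt hK)
    rwa [Nat.factorial_two] at h
  have hβ0 : 0 < β := pos_of_one_sub_inv_log_le hdK hk2 hβ'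
  by_cases hχ1 : χ = 1
  · -- `χ = 1`: Stark's Theorem 3 for `K` itself
    subst hχ1
    rw [classGroupLFunction_one K hne1] at h0
    obtain ⟨k, hk2', hkz⟩ := exists_quadratic_dedekindZetaCont_eq_zero K hK hβ' hβ1 h0
    obtain ⟨M, hM0, κ, hM, hM3, hκ, hsq, hprim, hLz⟩ :=
      Quadratic.exists_primitive_LFunction_eq_zero_of_realZero (k := k)
        ((finrank_rat_eq_finrank_rat _ _).trans hk2') hβ0 hβ1 hkz
    refine ⟨M, hM0, κ, hM3, ?_, hκ, hsq, hprim, hLz⟩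
    -- `M^{[K:k]} ∣ |d_K|`, `2·[K:k] = n`, so `M^n = (M^{[K:k]})² ∣ |d_K|²`
    have hdvd : M ^ Module.finrank k K ∣ (discr K).natAbs := by
      rw [hM]; exact natAbs_discr_pow_finrank_dvd k K
    have htower : Module.finrank ℚ k * Module.finrank k K = n := by
      rw [hn]; exact Module.finrank_mul_finrank ℚ k K
    have hkk : Module.finrank ℚ k = 2 := (finrank_rat_eq_finrank_rat _ _).trans hk2'
    rw [hkk] at htower
    have : M ^ n = (M ^ Module.finrank k K) ^ 2 := by rw [← pow_mul, mul_comm, htower]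
    rw [this]
    exact pow_dvd_pow_of_dvd hdvd 2
  · -- `χ ≠ 1`: Stark's Theorem 3 for the quadratic class field `E` of `χ`
    obtain ⟨E, hfd, hgal, h2, hunrAt, hzero⟩ := exists_quadratic_classField_dedekindZetaCont_eq_zero χ hχ hχ1
    haveI := hfd
    haveI := hgal
    haveI : NumberField E := NumberField.of_module_finite K E
    have hζE : dedekindZetaCont E β = 0 := hzero β hne1 h0
    -- degree `2n`, discriminant `d_K²`
    have hdegE : finrank ℚ E = 2 * n := by
      rw [← Module.finrank_mul_finrank ℚ K E, h2, hn, mul_comm]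
    have hdiscE : (discr E).natAbs = (discr K).natAbs ^ 2 := by
      rw [natAbs_discr_eq_pow_of_forall_isUnramifiedAt (K := K) hunrAt, h2]
    have hE1 : 1 < finrank ℚ E := by rw [hdegE]; omega
    -- Stark's window for `E`: `1 − 1/(4·(2n)!·log|d_E|) = 1 − 1/(8·(2n)!·log|d_K|)`
    have hβE : 1 - 1 / (4 * ((finrank ℚ E).factorial : ℝ) * Real.log ((discr E).natAbs : ℝ)) ≤ β := by
      rw [hdegE, hdiscE]
      push_cast
      rw [Real.log_pow]
      push_cast
      have : 1 / (4 * ((2 * n).factorial : ℝ) * (2 * Real.log ((discr K).natAbs : ℝ))) =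
          1 / (8 * ((2 * n).factorial : ℝ) * Real.log ((discr K).natAbs : ℝ)) := by
        congr 1; ring
      rw [this]
      exact hβ
    obtain ⟨k, hk2', hkz⟩ := exists_quadratic_dedekindZetaCont_eq_zero E hE1 hβE hβ1 hζE
    obtain ⟨M, hM0, κ, hM, hM3, hκ, hsq, hprim, hLz⟩ :=
      Quadratic.exists_primitive_LFunction_eq_zero_of_realZero (k := k)
        ((finrank_rat_eq_finrank_rat _ _).trans hk2') hβ0 hβ1 hkz
    refine ⟨M, hM0, κ, hM3, ?_, hκ, hsq, hprim, hLz⟩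
    -- `M^{[E:k]} ∣ |d_E| = |d_K|²` and `[E:k] = n`
    have hdvd : M ^ Module.finrank k E ∣ (discr E).natAbs := by
      rw [hM]; exact natAbs_discr_pow_finrank_dvd k E
    have htower : Module.finrank ℚ k * Module.finrank k E = 2 * n := by
      rw [← hdegE]
      exact (Module.finrank_mul_finrank ℚ k E).trans (finrank_rat_eq_finrank_rat _ _)
    have hkk : Module.finrank ℚ k = 2 := (finrank_rat_eq_finrank_rat _ _).trans hk2'
    rw [hkk] at htower
    have hkE : Module.finrank k E = n := by omega
    rw [hkE, hdiscE] at hdvd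
    exact hdvd

/-- The modulus bound in real form: `M^n ∣ d²`, `n ≥ 2`, `M ≥ 1` give `M ≤ d`. [folklore] -/
theorem le_of_pow_dvd_sq {M d n : ℕ} (hn : 2 ≤ n) (hd : 1 ≤ d) (h : M ^ n ∣ d ^ 2) : M ≤ d := by
  rcases Nat.eq_zero_or_pos M with hM | hM
  · omega
  have h1 : M ^ n ≤ d ^ 2 := Nat.le_of_dvd (by positivity) h
  have h2 : M ^ 2 ≤ M ^ n := Nat.pow_le_pow_right hM hn
  exact (Nat.pow_le_pow_iff_left (by norm_num : (2 : ℕ) ≠ 0)).mp (h2.trans h1)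

/-- **Siegel's theorem for class group `L`-functions (every degree; ineffective).**  For `n > 1` and
`ε > 0` there is `C > 0` such that for every number field `K` of degree `n`, every real class group
character `χ` of `K` (`χ = 1`, i.e. `ζ_K`, included) and every real zero `β < 1` of `L(s, χ)`:
`C · |d_K|^{−ε} ≤ 1 − β`.  (Inside the window `[1 − 1/(8(2n)! log|d_K|), 1)` the zero is a zero of a
quadratic Dirichlet `L`-function mod `M ≤ |d_K|`, to which Siegel's bound
`Siegel.exists_one_sub_realZero_ge` applies; outside it `1 − β > 1/(8(2n)! log|d_K|) ≥ ε/(8(2n)!)·|d_K|^{−ε}`.)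
[cite: MontgomeryVaughan2007, Corollary 11.15] [cite: Stark1974, Thm. 3] -/
theorem classGroupLFunction_siegel (n : ℕ) (hn : 1 < n) {ε : ℝ} (hε : 0 < ε) :
    ∃ C : ℝ, 0 < C ∧ ∀ (K : Type) [Field K] [NumberField K], finrank ℚ K = n →
      ∀ χ : ClassGroup (𝓞 K) →* ℂˣ, χ * χ = 1 → ∀ β : ℝ, β < 1 → classGroupLFunction K χ β = 0 →
        C * ((discr K).natAbs : ℝ) ^ (-ε) ≤ 1 - β := by
  obtain ⟨C₀, hC₀, hS⟩ := Siegel.exists_one_sub_realZero_ge hε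
  have hfac0 : (0 : ℝ) < ((2 * n).factorial : ℝ) := by exact_mod_cast Nat.factorial_pos _
  refine ⟨min C₀ (ε / (8 * ((2 * n).factorial : ℝ))), lt_min hC₀ (by positivity),
    fun K _ _ hKn χ hχ β hβ1 h0 => ?_⟩
  have hK : 1 < finrank ℚ K := by rw [hKn]; exact hn
  have hdK : 3 ≤ (discr K).natAbs := three_le_natAbs_discr K hK
  have hd3 : (3 : ℝ) ≤ ((discr K).natAbs : ℝ) := by exact_mod_cast hdK
  have hd1 : (1 : ℝ) ≤ ((discr K).natAbs : ℝ) := by linarith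
  have hlog : 0 < Real.log ((discr K).natAbs : ℝ) := Real.log_pos (by linarith)
  set d : ℝ := ((discr K).natAbs : ℝ) with hd
  have hdε : 0 < d ^ (-ε) := Real.rpow_pos_of_pos (by linarith) _
  have hdε1 : d ^ (-ε) ≤ 1 := Real.rpow_le_one_of_one_le_of_nonpos hd1 (by linarith)
  rcases lt_or_ge β (1 - 1 / (8 * ((2 * n).factorial : ℝ) * Real.log d)) with hout | hin
  · -- outside the window: `1 − β > 1/(8(2n)! log d) ≥ (ε/(8(2n)!)) d^{−ε}`
    have hlogle : Real.log d ≤ d ^ ε / ε := by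
      -- `log(d^ε) ≤ d^ε − 1` (the landed `Lichtman2020.log_le_rpow_div'` lives in a Sieve file; three lines here)
      have h := Real.log_le_sub_one_of_pos (Real.rpow_pos_of_pos (by linarith : (0 : ℝ) < d) ε)
      rw [Real.log_rpow (by linarith)] at h
      rw [le_div_iff₀ hε]; linarith
    have hdpos : 0 < d ^ ε := Real.rpow_pos_of_pos (by linarith) ε
    have h2 : ε * d ^ (-ε) * Real.log d ≤ 1 := by
      rw [Real.rpow_neg (by linarith)]
      calc ε * (d ^ ε)⁻¹ * Real.log d ≤ ε * (d ^ ε)⁻¹ * (d ^ ε / ε) := by gcongr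
        _ = 1 := by field_simp
    have hA : 0 < 8 * ((2 * n).factorial : ℝ) * Real.log d := by positivity
    have h1 : ε / (8 * ((2 * n).factorial : ℝ)) * d ^ (-ε) ≤
        1 / (8 * ((2 * n).factorial : ℝ) * Real.log d) := by
      calc ε / (8 * ((2 * n).factorial : ℝ)) * d ^ (-ε)
          = (ε * d ^ (-ε) * Real.log d) * (1 / (8 * ((2 * n).factorial : ℝ) * Real.log d)) := by
            field_simp
        _ ≤ 1 * (1 / (8 * ((2 * n).factorial : ℝ) * Real.log d)) := by gcongr
        _ = 1 / (8 * ((2 * n).factorial : ℝ) * Real.log d) := one_mul _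
    calc min C₀ (ε / (8 * ((2 * n).factorial : ℝ))) * d ^ (-ε)
        ≤ ε / (8 * ((2 * n).factorial : ℝ)) * d ^ (-ε) :=
          mul_le_mul_of_nonneg_right (min_le_right _ _) hdε.le
      _ ≤ 1 / (8 * ((2 * n).factorial : ℝ) * Real.log d) := h1
      _ ≤ 1 - β := by linarith
  · -- inside the window: a Dirichlet zero mod `M ≤ d`
    rw [← hKn] at hin
    obtain ⟨M, hM0, κ, hM3, hMdvd, hκ, hsq, -, hLz⟩ :=
      exists_dirichletCharacter_realZero_of_classGroupLFunction_eq_zero K hK χ hχ hin hβ1 h0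
    have hMle : M ≤ (discr K).natAbs := le_of_pow_dvd_sq (by omega) (by omega) hMdvd
    have hS' := hS M κ hsq hκ β hLz
    have hM1 : (1 : ℝ) ≤ (M : ℝ) := by exact_mod_cast (show 1 ≤ M by omega)
    have hmono : d ^ (-ε) ≤ (M : ℝ) ^ (-ε) :=
      Real.rpow_le_rpow_of_nonpos (by linarith) (by rw [hd]; exact_mod_cast hMle) (by linarith)
    calc min C₀ (ε / (8 * ((2 * n).factorial : ℝ))) * d ^ (-ε) ≤ C₀ * (M : ℝ) ^ (-ε) :=
          mul_le_mul (min_le_left _ _) hmono hdε.le hC₀.le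
      _ ≤ 1 - β := hS'

/-- **Siegel's theorem for the Dedekind zeta function of a number field of degree `n`** (the case
`χ = 1` of `classGroupLFunction_siegel`; Brauer–Siegel direction, via Stark's reduction to a quadratic
subfield): for `n > 1`, `ε > 0` there is `C > 0` with `C · |d_K|^{−ε} ≤ 1 − β` for every number field
`K` of degree `n` and every real zero `β < 1` of `ζ_K`. [cite: Stark1974, Thm. 3 and §1]
[cite: MontgomeryVaughan2007, Corollary 11.15] -/
theorem dedekindZetaCont_siegel (n : ℕ) (hn : 1 < n) {ε : ℝ} (hε : 0 < ε) :
    ∃ C : ℝ, 0 < C ∧ ∀ (K : Type) [Field K] [NumberField K], finrank ℚ K = n →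
      ∀ β : ℝ, β < 1 → dedekindZetaCont K β = 0 → C * ((discr K).natAbs : ℝ) ^ (-ε) ≤ 1 - β := by
  obtain ⟨C, hC, h⟩ := classGroupLFunction_siegel n hn hε
  refine ⟨C, hC, fun K _ _ hKn β hβ1 h0 => h K hKn 1 (by ext; simp) β hβ1 ?_⟩
  have hne1 : ((β : ℝ) : ℂ) ≠ 1 := by
    intro h1; apply hβ1.ne; exact_mod_cast h1
  rwa [classGroupLFunction_one K hne1]

end Literature.NumberTheory.LFunctions.NumberField

end
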